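import Summits.KontsevichZagierPeriods.KontsevichZagierPeriods.Theorems.GrothendieckSectorComplementStubJointKernel

/-!
# `H₁` is injectivity of `evalP` on the lemniscatic sector ring `ℤ[κ, ε, ϖ]`
# (stub `stub_lemRingKernel`, line `containment-join` (ring level), crux `Grothendieck.SectorComplement`,
# stmt-KontsevichZagierPeriods-11102)

In the formal period ring `P = FormalRep ⧸ relations` of the Kontsevich–Zagier calculus, Conjecture 1
on a sector is injectivity of the evaluation `evalP : P →+* ℝ` on a subring. This file lands the
ring-level reading of the route's rank-0 target `H₁ = LemniscaticSectorKernel` (Conjecture 1 in kernel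
form for `Fintype`-indexed `ℤ`-combinations of lemniscatic monomial representations of type `(a, b, c)`):
`H₁` gives injectivity of `evalP` on `ℤ[κ, ε, ϖ] = range ψ`, `ψ = aeval (⟦[k]⟧, ⟦[e]⟧, ⟦[p]⟧)`, for
ANY representation `p = [ℝ, 1/(1+x²)]` of `π`. Proof (part (B) of the landed adapter
`kernelOn_lem_of_lsk`): with the canonical monomial representations `m a b c` of `exists_monoRep`
(literal domain, literal integrand, class `⟦[k]⟧ᵃ ⟦[e]⟧ᵇ ⟦[p]⟧ᶜ`), the `P.support`-indexed combination
`c = ∑ᵥ coeff v P • [m v₀ v₁ v₂]` has class `ψ(P)` (`toFormalPeriod_sum_monoRep_eq_aeval`), so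
`eval c = evalP (ψ P) = 0`, `H₁` applies to `c` verbatim, `c ∈ relations`, and `ψ(P) = ⟦c⟧ = 0`
(`toFormalPeriod_eq_zero_iff`).

References: M. Kontsevich, D. Zagier, *Periods* (2001), §1.2, §4.1.
-/

noncomputable section

open MeasureTheory Set
open Literature.NumberTheory.Transcendental
open Literature.NumberTheory.Transcendental.KZ
open MvPolynomial (aeval X C)
open Summit.KontsevichZagierPeriods.KontsevichZagierPeriods.Theses.Grothendieck
open Summit.KontsevichZagierPeriods.Grothendieck.GpcLegendreLemniscaticNegative
open Summit.KontsevichZagierPeriods.Grothendieck.LemniscaticSectorGlue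
open Summit.KontsevichZagierPeriods.Grothendieck.SectorComplementAmalgamation
open Summit.KontsevichZagierPeriods.MzvKernelInKZ.Negative

namespace Summit.KontsevichZagierPeriods.Grothendieck.SectorComplementRingJoin

/-- **The `P.support`-indexed combination of monomial representations has class `ψ(P)`**: if
`m a b c` is any family of representations with classes `⟦[k]⟧ᵃ ⟦[e]⟧ᵇ ⟦[p]⟧ᶜ`, then
`⟦∑ᵥ coeff v P • [m v₀ v₁ v₂]⟧ = aeval (⟦[k]⟧, ⟦[e]⟧, ⟦[p]⟧) P` (`P = ∑ᵥ coeff v P • xᵛ`,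
`MvPolynomial.as_sum`, `aeval_monomial`). [Kontsevich–Zagier 2001, §4.1] -/
theorem toFormalPeriod_sum_monoRep_eq_aeval (p : IntegralRep 1)
    (m : ∀ a b c : ℕ, IntegralRep (a + b + c))
    (hmP : ∀ a b c, toFormalPeriod (of (m a b c)) =
      toFormalPeriod (of kRep) ^ a * toFormalPeriod (of eRep) ^ b * toFormalPeriod (of p) ^ c)
    (P : MvPolynomial (Fin 3) ℤ) :
    toFormalPeriod (∑ v : P.support, P.coeff v.1 • of (m (v.1 0) (v.1 1) (v.1 2))) =
      aeval ![toFormalPeriod (of kRep), toFormalPeriod (of eRep), toFormalPeriod (of p)] P := by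
  conv_rhs => rw [P.as_sum]
  rw [map_sum, map_sum, ← Finset.sum_coe_sort P.support]
  refine Finset.sum_congr rfl fun v _ => ?_
  rw [map_zsmul, hmP, MvPolynomial.aeval_monomial, Finsupp.prod_pow, Fin.prod_univ_three,
    zsmul_eq_mul, ← eq_intCast (algebraMap ℤ FormalPeriodRing)]
  rfl

/-- STUB S3a (registered `stub_lemRingKernel`): **`H₁` is injectivity of `evalP` on `ℤ[κ, ε, ϖ]`**:
under `LemniscaticSectorKernel`, every `ψ(P)`, `ψ = aeval (⟦k⟧, ⟦e⟧, ⟦p⟧)`, with `evalP (ψ P) = 0`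
vanishes — the `P.support`-indexed combination of the canonical monomial representations
(`exists_monoRep`) has class `ψ(P)` (`toFormalPeriod_sum_monoRep_eq_aeval`), value
`evalP (ψ P) = 0`, and `H₁` applies to it verbatim, so it lies in `relations`, i.e. `ψ(P) = 0`
(`toFormalPeriod_eq_zero_iff`). [Kontsevich–Zagier 2001, §1.2] -/
theorem stub_lemRingKernel :
    LemniscaticSectorKernel →
    ∀ (p : IntegralRep 1), p.domain = Set.univ → (p.integrand = fun x => 1 / (1 + x 0 ^ 2)) →
      ∀ P : MvPolynomial (Fin 3) ℤ,
        evalP (aeval ![toFormalPeriod (of kRep), toFormalPeriod (of eRep), toFormalPeriod (of p)] P) = 0 →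
        aeval ![toFormalPeriod (of kRep), toFormalPeriod (of eRep), toFormalPeriod (of p)] P = 0 := by
  intro h1 p hpd hpi P hP0
  choose m hmd hmi hmP using fun a b c => exists_monoRep p hpd hpi a b c
  have hsum := toFormalPeriod_sum_monoRep_eq_aeval p m hmP P
  have hrel : (∑ v : P.support, P.coeff v.1 • of (m (v.1 0) (v.1 1) (v.1 2))) ∈ relations := by
    refine h1 P.support (fun v => P.coeff v.1) (fun v => v.1 0) (fun v => v.1 1) (fun v => v.1 2)
      (fun v => m (v.1 0) (v.1 1) (v.1 2)) (fun v => hmd _ _ _)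
      (fun v => by rw [hmi]; exact fun _ _ => rfl) ?_
    rw [← evalP_toFormalPeriod, hsum, hP0]
  rw [← hsum, toFormalPeriod_eq_zero_iff]
  exact hrel

end Summit.KontsevichZagierPeriods.Grothendieck.SectorComplementRingJoin

end
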